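import Summits.ResolutionOfSingularities.ResolutionOfSingularities.Theses.WeightedInvariant
import Literature.AlgebraicGeometry.Resolution.ResolutionOfComponents
import Mathlib.AlgebraicGeometry.Morphisms.ClosedImmersion

/-!
# `WeightedThesis` / `DatumToEmbedded` — the zero-step case of the cobordant tower

Support lemmas for crux `stmt-ResolutionOfSingularities-0569`, line `datum-glued-split`, stub
`stub_datumToEmbedded` (= support item stmt-0572): the TERMINAL case of the well-founded induction
on `max inv` — when the invariant of a weighted resolution datum is everywhere minimal on
`(Y, X)`, axiom `(ii)` says every local ring of the closed subscheme `X` is regular, so `X` is its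
own resolution. Together with the reduction of `DatumToEmbedded` to its non-minimal case.
-/

noncomputable section

open CategoryTheory AlgebraicGeometry
open Literature.AlgebraicGeometry.Resolution
open Summit.ResolutionOfSingularities.ResolutionOfSingularities.Theses.WeightedInvariant

set_option linter.dupNamespace false

namespace Summit.ResolutionOfSingularities.ResolutionOfSingularities.Theorems.WeightedThesis.ZeroStep

variable {p : ℕ} (D : WeightedResolutionDatum p)
variable {k : Type} [Field k] [CharP k p] [PerfectField k] {Y : Scheme.{0}}
  (f : Y ⟶ Spec (.of k)) [Smooth f] [IsSeparated f] [QuasiCompact f]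

/-- **Zero-step case, subscheme form.** If the invariant of the datum is everywhere minimal on
`(Y, X)` then the closed subscheme `X` (Mathlib `X.subscheme`) is regular: axiom `(ii)` at each
point of `X`. [folklore] -/
theorem isRegular_subscheme_of_forall_isBot (X : Y.IdealSheafData)
    (h : ∀ y : Y, IsBot (D.inv f X y)) : Scheme.IsRegular X.subscheme := fun x =>
  (D.isBot_inv_iff f X (X.subschemeι x)).mp (h _) x rfl

/-- **Zero-step case, closed-immersion form.** For a closed immersion `i : X ⟶ Y` whose kernel
ideal sheaf has everywhere-minimal invariant, `X` has a resolution (the identity): `X ≅ i.image =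
(i.ker).subscheme` is regular. [folklore] -/
theorem hasResolution_of_forall_isBot {X : Scheme.{0}} (i : X ⟶ Y) [IsClosedImmersion i]
    (h : ∀ y : Y, IsBot (D.inv f i.ker y)) : Scheme.HasResolution X :=
  (Scheme.IsRegular.hasResolution (isRegular_subscheme_of_forall_isBot D f i.ker h)).of_iso
    (inv i.toImage)

/-- **`DatumToEmbedded` reduces to the non-minimal case**: it suffices to resolve the integral
closed `X ⊆ Y` for which the invariant is NOT everywhere minimal (the guard of axioms
`(iii)`/`(iv)`), the minimal case being the zero-step case above. [folklore] -/
theorem datumToEmbedded_of_nonminimal : (∀ (p : ℕ), p.Prime → ∀ (D : Literature.AlgebraicGeometry.Resolution.WeightedResolutionDatum p) (k : Type) [Field k] [CharP k p] [PerfectField k] (Y X : AlgebraicGeometry.Scheme.{0}) (f : Y ⟶ AlgebraicGeometry.Spec (.of k)) (i : X ⟶ Y), AlgebraicGeometry.Smooth f → AlgebraicGeometry.IsSeparated f → AlgebraicGeometry.QuasiCompact f → AlgebraicGeometry.IsClosedImmersion i → AlgebraicGeometry.IsIntegral X → (∃ y : Y, ¬ IsBot (D.inv f i.ker y)) → Literature.AlgebraicGeometry.Resolution.Scheme.HasResolution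 X) → Summit.ResolutionOfSingularities.ResolutionOfSingularities.Theses.WeightedInvariant.DatumToEmbedded := by
  intro H p hp hD k _ _ _ Y X f i hf hsep hqc hi hint
  obtain ⟨D⟩ := hD
  haveI := hf; haveI := hsep; haveI := hqc; haveI := hi
  by_cases h : ∀ y : Y, IsBot (D.inv f i.ker y)
  · exact hasResolution_of_forall_isBot D f i h
  · push Not at h
    exact H p hp D k Y X f i hf hsep hqc hi hint h

end Summit.ResolutionOfSingularities.ResolutionOfSingularities.Theorems.WeightedThesis.ZeroStep

end
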